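import Mathlib.Analysis.Matrix.Spectrum
import Mathlib.Order.Interval.Finset.Fin
import HarnessLib

/-!
# From an order-preserving residual pairing and TWO eigenvalue counts to INDEXED enclosures of an
# INTERIOR window of the spectrum

The interior companion of `IndexedEnclosureFromCount` («shift-and-invert Lanczos about `σ` proposes,
two inertia counts certify that nothing in the window was missed»).  For a real symmetric / Hermitian `A`
with descending eigenvalues `λ↓₀ ≥ ⋯ ≥ λ↓_{n−1}` (Mathlib's antitone `eigenvalues₀`) one has

* a RESIDUAL PAIRING (Kahan 1967 / Stewart–Sun Cor IV.4.15; tree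
  `Literature.Analysis.InnerProduct.exists_strictMono_abs_eigenvalues₀_sub_le_of_gram_bounds`): a strictly
  increasing `f : Fin k → Fin n` with `|λ↓_{f j} − θ_j| ≤ ρ` for the `k` Ritz values `θ_j` of a frame, all
  of whose intervals `[θ_j − ρ, θ_j + ρ]` lie inside an open window `(a, b)`;
* TWO EIGENVALUE COUNTS (spectrum slicing, Golub–Van Loan §8.4.2, (8.4.3) «the number of eigenvalues in
  `[a, b)` is `ν(b) − ν(a)`»; tree `EigenvalueCountCertificates.card_pos_le_card_eigenvalues_gt_sub_of_residual`
  / `card_eigenvalues_gt_add_le_card_pos_of_residual`): at most `ν_b` eigenvalues are `≤ b` and at least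
  `ν_a` are `≤ a`, with `ν_b = ν_a + k`.

Then the `k` paired eigenvalues are EXACTLY the eigenvalues in the window, consecutively: `f j = n − ν_b + j`
(descending index; ascending index `ν_a + j`), every `θ_j ± ρ` encloses its own eigenvalue, every
eigenvalue of descending index `< n − ν_b` exceeds `b` and every one of index `≥ n − ν_a` is `≤ a` — no
eigenvalue inside the window was missed.  The content is purely order-theoretic
(`pairing_window_of_counts`); `eigenvalues₀_pairing_window_of_counts` is the matrix instance.  Everything
is proved; no floating point (the pairing and the two counts are hypotheses in exactly the form the tree
theorems above conclude).

## References
* [GolubVanLoan2013] G. H. Golub, C. F. Van Loan, *Matrix Computations*, 4th ed. (2013), §8.4.2 (8.4.3)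
  (eigenvalue counts in an interval from two `LDLᵀ` inertias) — the counts.
* [StewartSun1990] G. W. Stewart, J.-G. Sun, *Matrix Perturbation Theory* (1990), Cor IV.4.15 /
  Exercise IV.4.7 (Kahan) — the pairing.
-/

namespace Literature.Analysis.Matrix

open Finset

section Order

variable {n k : ℕ}

/-- A strictly increasing map `f : Fin k → Fin n` gains at least the index difference:
`f j + d ≤ f (j + d)` (private helper). [folklore] -/
private theorem val_add_le_of_strictMono' {f : Fin k → Fin n} (hf : StrictMono f) (j : Fin k) (d : ℕ)
    (h : (j : ℕ) + d < k) : (f j : ℕ) + d ≤ (f ⟨j + d, h⟩ : ℕ) := by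
  induction d with
  | zero => simp
  | succ d ih =>
    have h' : (j : ℕ) + d < k := by omega
    have hlt : f ⟨(j : ℕ) + d, h'⟩ < f ⟨(j : ℕ) + (d + 1), h⟩ :=
      hf (Fin.mk_lt_mk.2 (by omega))
    have hlt' : (f ⟨(j : ℕ) + d, h'⟩ : ℕ) < (f ⟨(j : ℕ) + (d + 1), h⟩ : ℕ) := Fin.lt_def.1 hlt
    have := ih h'
    omega

/-- A strictly increasing `f : Fin k → Fin n` whose values all lie in the integer window `[p, p + k)` is
forced: `f j = p + j` (private helper). [folklore] -/
private theorem val_eq_of_strictMono_of_mem_window {f : Fin k → Fin n} (hf : StrictMono f) {p : ℕ}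
    (hmem : ∀ j, p ≤ (f j : ℕ) ∧ (f j : ℕ) < p + k) (j : Fin k) : (f j : ℕ) = p + j := by
  have hjk : (j : ℕ) < k := j.isLt
  have h0 : (0 : ℕ) + (j : ℕ) < k := by omega
  have hlo := val_add_le_of_strictMono' hf ⟨0, by omega⟩ (j : ℕ) h0
  have hcast : (⟨(0 : ℕ) + (j : ℕ), h0⟩ : Fin k) = j := Fin.ext (by simp)
  rw [hcast] at hlo
  have hlow0 := (hmem ⟨0, by omega⟩).1
  have hkj : (j : ℕ) + (k - 1 - j) < k := by omega
  have hhi := val_add_le_of_strictMono' hf j (k - 1 - (j : ℕ)) hkj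
  have hlast := (hmem ⟨(j : ℕ) + (k - 1 - (j : ℕ)), hkj⟩).2
  omega

/-- For an antitone `ev`, a sublevel set `{i | ev i ≤ c}` is a final segment: it equals
`{i | n − m ≤ i}` where `m` is its cardinality (private helper). [folklore] -/
private theorem mem_sublevel_iff_of_antitone {ev : Fin n → ℝ} (hev : Antitone ev) (c : ℝ) (i : Fin n) :
    ev i ≤ c ↔ n - #{i' : Fin n | ev i' ≤ c} ≤ (i : ℕ) := by
  classical
  set T : Finset (Fin n) := univ.filter fun i' : Fin n => ev i' ≤ c with hT
  constructor
  · intro hi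
    have hsub : Ici i ⊆ T := fun i' hi' => mem_filter.2 ⟨mem_univ _, (hev (mem_Ici.1 hi')).trans hi⟩
    have hle := card_le_card hsub
    rw [Fin.card_Ici] at hle
    omega
  · intro hi
    by_contra hnot
    -- every member of `T` lies strictly above `i` (else `i ∈ T` by antitonicity)
    have hsub : T ⊆ Ioi i := fun i' hi' => by
      rw [mem_Ioi]
      by_contra hle
      exact hnot ((hev (not_lt.1 hle)).trans (mem_filter.1 hi').2)
    have hle := card_le_card hsub
    rw [Fin.card_Ioi] at hle
    omega

/-- **Pairing + two counts ⇒ the paired indices are the window.** Let `ev : Fin n → ℝ` be antitone,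
`f : Fin k → Fin n` strictly increasing with `a < ev (f j) < b` for every `j` (`a ≤ b`), at most `νb`
values of `ev` at most `b`, at least `νa` values at most `a`, and `νb = νa + k`.  Then `f j = n − νb + j`
for every `j`, `b < ev i` for every index `i < n − νb`, and `ev i ≤ a` for every index `i ≥ n − νa`
(private helper; the public, cited form is `pairing_window_of_counts`). [folklore] -/
private theorem strictMono_pairing_eq_window {ev : Fin n → ℝ} (hev : Antitone ev) {f : Fin k → Fin n}
    (hf : StrictMono f) {a b : ℝ} (hab : a ≤ b) (hin : ∀ j, a < ev (f j) ∧ ev (f j) < b) {νa νb : ℕ}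
    (hb : #{i : Fin n | ev i ≤ b} ≤ νb) (ha : νa ≤ #{i : Fin n | ev i ≤ a}) (hk : νb = νa + k) :
    (∀ j, (f j : ℕ) = n - νb + j) ∧ (∀ i : Fin n, (i : ℕ) < n - νb → b < ev i) ∧
      ∀ i : Fin n, n - νa ≤ (i : ℕ) → ev i ≤ a := by
  classical
  set Tb : Finset (Fin n) := univ.filter fun i : Fin n => ev i ≤ b with hTb
  set Ta : Finset (Fin n) := univ.filter fun i : Fin n => ev i ≤ a with hTa
  have himg : univ.image f ⊆ Tb \ Ta := by
    intro i hi
    obtain ⟨j, -, rfl⟩ := mem_image.1 hi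
    exact mem_sdiff.2 ⟨mem_filter.2 ⟨mem_univ _, (hin j).2.le⟩,
      fun h => (not_le.2 (hin j).1) (mem_filter.1 h).2⟩
  have hcardimg : (univ.image f).card = k := by
    rw [card_image_of_injective _ hf.injective, card_univ, Fintype.card_fin]
  have hTaTb : Ta ⊆ Tb := fun i hi => mem_filter.2 ⟨mem_univ _, ((mem_filter.1 hi).2).trans hab⟩
  have hsplit : (Tb \ Ta).card + Ta.card = Tb.card := card_sdiff_add_card_eq_card hTaTb
  have hk' : k ≤ (Tb \ Ta).card := hcardimg ▸ card_le_card himg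
  -- the two counts are therefore EXACT
  have hTb_card : Tb.card = νb := by omega
  have hTa_card : Ta.card = νa := by omega
  have hsd_card : (Tb \ Ta).card = k := by omega
  have himg_eq : univ.image f = Tb \ Ta := eq_of_subset_of_card_le himg (by rw [hcardimg, hsd_card])
  -- final-segment structure of the two sublevel sets
  have hmemb : ∀ i : Fin n, ev i ≤ b ↔ n - νb ≤ (i : ℕ) := fun i => by
    rw [mem_sublevel_iff_of_antitone hev b i, ← hTb, hTb_card]
  have hmema : ∀ i : Fin n, ev i ≤ a ↔ n - νa ≤ (i : ℕ) := fun i => by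
    rw [mem_sublevel_iff_of_antitone hev a i, ← hTa, hTa_card]
  have hνb_le : νb ≤ n := by
    have := card_le_univ Tb; rw [Fintype.card_fin] at this; omega
  refine ⟨fun j => val_eq_of_strictMono_of_mem_window hf (fun j => ⟨?_, ?_⟩) j, fun i hi => ?_, fun i hi => ?_⟩
  · exact (hmemb (f j)).1 (hin j).2.le
  · have hna : ¬ ev (f j) ≤ a := not_le.2 (hin j).1
    rw [hmema] at hna
    omega
  · by_contra hcon
    have := (hmemb i).1 (not_lt.1 hcon)
    omega
  · exact (hmema i).2 hi

/-- **Indexed two-sided enclosures of an INTERIOR WINDOW from a residual pairing and two counts**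
(order-theoretic form).  With `ev` antitone, a strictly increasing pairing `f` with `|ev (f j) − θ_j| ≤ ρ`,
every interval inside the window (`a < θ_j − ρ`, `θ_j + ρ < b`, `a ≤ b`), at most `νb` values of `ev`
at most `b`, at least `νa` values at most `a`, and `νb = νa + k`: the `j`-th paired value IS the
`(n − νb + j)`-th entry, `|ev (f j) − θ_j| ≤ ρ` reads as an enclosure of that entry, and the entries of
index `< n − νb` exceed `b` while those of index `≥ n − νa` are `≤ a`.
[cite: GolubVanLoan2013, §8.4.2 (8.4.3) (counts in an interval) composed with Stewart–Sun Cor IV.4.15 (pairing)] -/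
theorem pairing_window_of_counts {ev : Fin n → ℝ} (hev : Antitone ev) {θ : Fin k → ℝ} {ρ a b : ℝ}
    {f : Fin k → Fin n} (hf : StrictMono f) (hpair : ∀ j, |ev (f j) - θ j| ≤ ρ)
    (hab : a ≤ b) (hlo : ∀ j, a < θ j - ρ) (hhi : ∀ j, θ j + ρ < b) {νa νb : ℕ}
    (hb : #{i : Fin n | ev i ≤ b} ≤ νb) (ha : νa ≤ #{i : Fin n | ev i ≤ a}) (hk : νb = νa + k) :
    (∀ j, (f j : ℕ) = n - νb + j ∧ θ j - ρ ≤ ev (f j) ∧ ev (f j) ≤ θ j + ρ) ∧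
      (∀ i : Fin n, (i : ℕ) < n - νb → b < ev i) ∧ ∀ i : Fin n, n - νa ≤ (i : ℕ) → ev i ≤ a := by
  have hin : ∀ j, a < ev (f j) ∧ ev (f j) < b := fun j => by
    have h1 := (abs_sub_le_iff.1 (hpair j)).1
    have h2 := (abs_sub_le_iff.1 (hpair j)).2
    exact ⟨by linarith [hlo j], by linarith [hhi j]⟩
  obtain ⟨hidx, hleft, hright⟩ := strictMono_pairing_eq_window hev hf hab hin hb ha hk
  refine ⟨fun j => ⟨hidx j, ?_, ?_⟩, hleft, hright⟩
  · have h := (abs_sub_le_iff.1 (hpair j)).2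
    linarith
  · have h := (abs_sub_le_iff.1 (hpair j)).1
    linarith

end Order

section Hermitian

variable {𝕜 : Type*} [RCLike 𝕜] {ι : Type*} [Fintype ι] [DecidableEq ι]

/-- **Indexed enclosures of the eigenvalues in an interior window from a pairing and two counts.** Let
`A` be Hermitian with descending eigenvalues `λ↓ = hA.eigenvalues₀`, `f : Fin k → Fin (card ι)` a strictly
increasing residual pairing with `|λ↓_{f j} − θ_j| ≤ ρ` (Kahan, for a Ritz frame about a shift), every Ritz
interval inside the window (`a < θ_j − ρ`, `θ_j + ρ < b`, `a ≤ b`), and two inertia counts giving «at most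
`νb` eigenvalues `≤ b`» and «at least `νa` eigenvalues `≤ a`» with `νb = νa + k`.  Then `f j = card ι − νb + j`
(ascending index `νa + j`): each `[θ_j − ρ, θ_j + ρ]` encloses ITS OWN eigenvalue, the `νb − νa` eigenvalues
of the window are exactly the paired ones (none missed), the eigenvalues of descending index `< card ι − νb`
exceed `b`, and those of index `≥ card ι − νa` are `≤ a`.
[cite: GolubVanLoan2013, §8.4.2 (8.4.3) (counts in an interval) composed with Stewart–Sun Cor IV.4.15 (pairing)] -/
theorem eigenvalues₀_pairing_window_of_counts {A : _root_.Matrix ι ι 𝕜} (hA : A.IsHermitian) {k : ℕ}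
    {θ : Fin k → ℝ} {ρ a b : ℝ} {f : Fin k → Fin (Fintype.card ι)} (hf : StrictMono f)
    (hpair : ∀ j, |hA.eigenvalues₀ (f j) - θ j| ≤ ρ) (hab : a ≤ b)
    (hlo : ∀ j, a < θ j - ρ) (hhi : ∀ j, θ j + ρ < b) {νa νb : ℕ}
    (hb : #{i : Fin (Fintype.card ι) | hA.eigenvalues₀ i ≤ b} ≤ νb)
    (ha : νa ≤ #{i : Fin (Fintype.card ι) | hA.eigenvalues₀ i ≤ a}) (hk : νb = νa + k) :
    (∀ j, (f j : ℕ) = Fintype.card ι - νb + j ∧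
        θ j - ρ ≤ hA.eigenvalues₀ (f j) ∧ hA.eigenvalues₀ (f j) ≤ θ j + ρ) ∧
      (∀ i : Fin (Fintype.card ι), (i : ℕ) < Fintype.card ι - νb → b < hA.eigenvalues₀ i) ∧
      ∀ i : Fin (Fintype.card ι), Fintype.card ι - νa ≤ (i : ℕ) → hA.eigenvalues₀ i ≤ a :=
  pairing_window_of_counts hA.eigenvalues₀_antitone hf hpair hab hlo hhi hb ha hk

end Hermitian

end Literature.Analysis.Matrix
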